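import Literature.MathematicalPhysics.QuantumFieldTheory.Balaban1983to89.Node00.Satisfiable
import Literature.MathematicalPhysics.QuantumFieldTheory.Balaban1983to89.Node00.Carriers3

/-!
# `Balaban1983to89.B9LeafUnpinned` — DAG node N06 · [Balaban1985BackgroundPropagators]: the typed leaf `DagBinding.B9LeafX` is REFUTABLE over an
# un-pinned B9 bundle, hence N06 is NOT closable over NODE 00's Stage-2 frame, and at Stage 3 it contradicts N03 at some world of record — the
# kernel-checked reason the node waits for a B9 PIN (companion of `…B9LeafKnit`; R422 typing policy at node level)

B9 = T. Bałaban, *Propagators for lattice gauge theories in a background field*, Commun. Math. Phys. **99** (1985) 389–434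
[Balaban1985BackgroundPropagators]; [B6] = [Balaban1984PropagatorsII]; [B7] = [Balaban1985Averaging].

YM-PLAN Track A, node N06 (`Dag.B9_main ℓ := ℓ.b4 → ℓ.b5 → ℓ.b6 → ℓ.b7 → ℓ.b9`; leaf `b9 ↦ DagBinding.B9LeafX Y`).  Seat `pub-ymgap-dag-n06-a`.  THEOREMS ONLY
(0 `def`, 0 `sorry`, standard axioms).  The dagwriter's `not_paperClusters_over_stage2Frame` records at CLUSTER level that per-node stubs typed over a
stage that does not pin their carriers include false ones; this module records the N06 instance with an explicit witness and sharpens it to Stage 3: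

* §1 `exists_not_thm31Printed` — an INHABITED bundle `Y : PrintedCarriers9X` (family index `ℕ`, member `n` with `M = n`; regularity condition (3.35)
  vacuous; `|λ| ≡ 0` while the sup entry `|(G′λ)(x)| ≡ 1`) at which Theorem 3.1 AS TYPED (`B9.Thm31Printed`, (3.42) p. 397) FAILS; hence
  `exists_not_b9LeafX`, `not_forall_b9LeafX` — the typed leaf is not a tautology of its carriers: a pin of record must carry the genuine lattice norms
  (3.39)–(3.41) and operators.
* §2 `exists_isWorldOfRecord₂_not_b9_main` — a world of record OF NODE 00's STAGE 2 (admissible `θ`, `D = 4`; [B4] ∕ [B5] ∕ [B7] groups the lineages'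
  objects; the run's FREE [B6] block set to the lineage's one-level knit block `Node00.withB6OfRecord X D L 1 1 0`, at which `b6` HOLDS by
  `Node00.b6_withB6OfRecord`; the run's free B9 bundle := the witness of §1) at which `Dag.B9_main (leavesP w P)` FAILS for every run; hence
  `not_b9_main_over_stage2` : ¬ (∀ w, IsWorldOfRecord₂ w → ∀ P, Dag.B9_main (leavesP w P)).
* §3 `exists_isWorldOfRecord₃_b6_main_imp_not_b9_main` — at Stage 3 the [B6] block IS the tower block of record (`Node00.D6OfRecord θ`, its leaf open
  modulo the Prop. 2.6 census), so N06 is not refuted outright there; but at some Stage-3 world of record (B9 bundle := the witness of §1)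
  **N03 ⇒ ¬ N06 for every run** — the Stage-3 frame cannot carry the K2 cluster «FlowBounds» (N03 ∧ N06 ∧ …) either: a B9-pinning stage is needed
  (`B9LeafKnit.b9_main_of_pinnedB9` is the shape that stage instantiates).

HONEST FRAMING: kernel bookkeeping about the TYPED leaf over degenerate carriers — it says nothing against [B9]'s theorems at Bałaban's objects; it says
where the node must be read.  Count-neutral; nothing continuum ∕ ℝ⁴ ∕ OS ∕ mass-gap ∕ Clay.
-/

noncomputable section

namespace Literature.MathematicalPhysics.QuantumFieldTheory.Balaban1983to89.B9LeafUnpinned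

open DagBinding DagDischargedII

/-! ## §1 An inhabited B9 bundle at which Theorem 3.1 as typed fails -/

/-- **Theorem 3.1 AS TYPED is refutable over an un-pinned bundle**: there is `Y : PrintedCarriers9X` with NON-EMPTY family index at which
`B9.Thm31Printed Y.c35 Y.geo9 Y.bg9 Y.Gp` fails (member `n : ℕ` has `M = n`, so every threshold `M ≥ M₁` is met; (3.35) is vacuous; `Mα₀ ≤ a₀` is met
by `α₀ := a₀/(n+1)`; the sup norm of every argument is `0` while the first sup entry of (3.42) is `1`). [cite: Balaban1985BackgroundPropagators, Thm 3.1 (3.42) p.397 (bookkeeping: the typed statement over degenerate carriers)] -/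
theorem exists_not_thm31Printed :
    ∃ Y : PrintedCarriers9X, Nonempty Y.I9 ∧ ¬ B9.Thm31Printed Y.c35 Y.geo9 Y.bg9 Y.Gp := by
  let g : ℕ → B9.Geometry := fun n =>
    { Site := PUnit, scale := fun _ => 0, dist := fun _ _ => 0, k := 0, eta := 1, L := 1, M := n, Loc := PUnit,
      suppIn := fun _ _ => True, suppInT := fun _ _ => True, supNorm := fun _ => 0, l2Norm := fun _ => 0, wNorm := fun _ _ => 0,
      holder := fun _ _ => 0, Cut := PUnit, cutIn := fun _ _ => True, cutInT := fun _ _ => True, cutH := fun _ _ => 0,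
      cutSup := fun _ => 0, suppInT_of_suppIn := fun _ _ h => h, cutInT_of_cutIn := fun _ _ h => h }
  let B : B9.Backgrounds :=
    { Cfg := PUnit, one := PUnit.unit, mul := fun _ _ => PUnit.unit, Reg335 := fun _ _ _ => True, Reg336 := fun _ _ _ => True,
      Cplx337 := fun _ _ _ => True, Cplx338 := fun _ _ _ => True }
  let K : ∀ n : ℕ, B9.KernelFamily (g n) B := fun _ =>
    { e := fun _ _ _ _ => 1, h1 := fun _ _ _ _ => 0, e4 := fun _ _ _ => 0, h2 := fun _ _ _ _ => 0, l2 := fun _ _ _ _ => 0,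
      glob := fun _ _ _ _ => 0 }
  let E : ∀ n : ℕ, B9.RWExpansion (g n) B := fun _ =>
    { Walk := PUnit, wlen := fun _ => 0, first := fun _ _ => True, last := fun _ _ => True, wdist := fun _ _ _ => 0,
      term := fun _ _ _ _ => 0, LocDep := fun _ _ => True, Converges := fun _ => True }
  let EK : ∀ n : ℕ, B9.RWKernelExpansion (g n) B := fun _ =>
    { Walk := PUnit, wlen := fun _ => 0, wdist := fun _ _ _ => 0, kterm := fun _ _ _ _ => 0, LocDep := fun _ _ => True,
      Converges := fun _ => True }
  let Hk : ∀ n : ℕ, B9.HKernel (g n) B := fun _ => { e := fun _ _ _ _ => 0, h := fun _ _ _ _ => 0 }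
  let Y : PrintedCarriers9X :=
    { I9 := ℕ, d9 := 0, c35 := 1, geo9 := g, bg9 := fun _ => B, InCube := fun _ => True, Gp := K, GA := K,
      Cinv := fun _ => ⟨fun _ _ _ => 0⟩, IsAnalyticExt := fun _ _ _ _ => True, E37 := E, EK39 := EK, E310 := E,
      PosDef := fun _ _ _ => True, GD := K, G₁ := K, H := Hk, H₁ := Hk, HasRWExp := fun _ _ _ _ => True,
      HasRWExpH := fun _ _ _ _ => True, PosDefK := fun _ _ _ => True, GG := K, Kdiff := K, dOmega := fun _ _ _ => 0,
      Ck := fun _ => ⟨fun _ _ _ => 0⟩, inΛ := fun _ _ => True, unitDist := fun _ _ _ => 0, GivenBy3185 := fun _ _ => True,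
      HasRWExpC := fun _ _ _ => True, P349 := fun _ => ⟨fun _ _ _ _ => 0⟩, QGQinv := fun _ => ⟨fun _ _ _ => 0⟩,
      QG1Qinv := fun _ => ⟨fun _ _ _ => 0⟩, OmK := fun _ _ => True }
  refine ⟨Y, ⟨(0 : ℕ)⟩, ?_⟩
  rintro ⟨M₁, δ₀, a₀, B₀, Bβ, Bε, Bεβ, -, -, ha, -, H⟩
  obtain ⟨n, hn⟩ := exists_nat_ge M₁
  have hα : 0 < a₀ / ((n : ℝ) + 1) := by positivity
  have hMa : (n : ℝ) * (a₀ / ((n : ℝ) + 1)) ≤ a₀ := by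
    rw [mul_div_assoc', div_le_iff₀ (by positivity)]
    nlinarith [ha.le]
  have h := (H n hn _ hα hMa PUnit.unit trivial).1.1 0 PUnit.unit PUnit.unit PUnit.unit trivial
  have h' : (1 : ℝ) ≤ 0 := by simpa [Y, K, g] using h
  linarith

/-- Hence the EXTENDED LEAF `B9LeafX` is refutable over an un-pinned, inhabited bundle (Theorem 3.1 is its field `numbered.t31`).
[cite: Balaban1985BackgroundPropagators, Thms 3.1–3.15 pp.397–432 (bookkeeping: the typed leaf over degenerate carriers)] -/
theorem exists_not_b9LeafX : ∃ Y : PrintedCarriers9X, Nonempty Y.I9 ∧ ¬ B9LeafX Y := by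
  obtain ⟨Y, hY, h⟩ := exists_not_thm31Printed
  exact ⟨Y, hY, fun hX => h hX.numbered.t31⟩

/-- … so «the B9 leaf at every bundle» is FALSE: a discharge of N06 must read the leaf at NODE 00's PINNED bundle of record.
[cite: Balaban1985BackgroundPropagators, Thms 3.1–3.15 pp.397–432 (bookkeeping)] -/
theorem not_forall_b9LeafX : ¬ ∀ Y : PrintedCarriers9X, B9LeafX Y := by
  obtain ⟨Y, -, h⟩ := exists_not_b9LeafX
  exact fun hall => h (hall Y)

/-! ## §2 N06 is not closable over the Stage-2 frame of NODE 00 -/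

/-- **A Stage-2 world of record at which N06 FAILS for every run.**  Parameters: the root's admissible `θ` (`D = 4`), coefficient algebra `ℂ`; the
run's free [B6] block := the lineage's one-level knit block (`Node00.withB6OfRecord X D L 1 1 0`, so `b6` HOLDS by `Node00.b6_withB6OfRecord` — the
antecedent is genuinely met, not vacuous); `b4`, `b5`, `b7` hold at Stage 2 (`Node00.carriers₁_b4 ∕ _b5`, `carriers₂_b7`); the run's free B9 bundle :=
the witness of `exists_not_b9LeafX`. [cite: Balaban1985BackgroundPropagators, Thms 3.1–3.15 pp.397–432; Balaban1984PropagatorsII, pp.234–249; Balaban1985Averaging, Props. 1–10 pp.26–50 (bookkeeping over the staged predicates)] -/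
theorem exists_isWorldOfRecord₂_not_b9_main :
    ∃ w : WorldP, Node00.IsWorldOfRecord₂ w ∧ ∀ P : B12.RunParams, ¬ Dag.B9_main (leavesP w P) := by
  obtain ⟨θ, hθ, -⟩ := Node00.Stage1Params.exists_admissible
  obtain ⟨X⟩ := Node00.nonempty_printedCarriersR
  obtain ⟨Y, -, hY⟩ := exists_not_b9LeafX
  obtain ⟨Z⟩ := Node00.nonempty_printedCarriers11
  obtain ⟨V⟩ := Node00.nonempty_printedCarriers14R
  obtain ⟨W⟩ := Node00.nonempty_printedCarriers15
  obtain ⟨w⟩ := Node00.nonempty_worldP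
  let θ₂ : Node00.Stage2Params := { θ with 𝔸 := ℂ }
  let X' : PrintedCarriersR := Node00.withB6OfRecord X θ.D θ.L 1 1 0
  refine ⟨Node00.WorldP.withUp w fun _ => Upstream.ofPrintedAllXPN (Node00.carriers₂ θ₂ X') Y Z V W,
    Node00.isWorldOfRecord₂_of_up θ₂ hθ X' Y Z V W _ rfl, fun P hmain => hY ?_⟩
  have hb6 : (Upstream.ofPrintedAllXPN (Node00.carriers₂ θ₂ X') Y Z V W).b6 :=
    Node00.b6_withB6OfRecord X Y Z V W hθ.1 θ.hL one_pos one_pos le_rfl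
  exact hmain (Node00.carriers₁_b4 _ hθ _ Y Z V W) (Node00.carriers₁_b5 _ hθ _ Y Z V W) hb6 (Node00.carriers₂_b7 θ₂ X' Y Z V W)

/-- **N06 is NOT closable over NODE 00's Stage-2 frame** (so `stub_N06` must be typed over a stage that PINS the B9 bundle — R422; the knit
`B9LeafKnit.b9_main_of_pinnedB9` is the shape). [cite: Balaban1985BackgroundPropagators, Thms 3.1–3.15 pp.397–432 (bookkeeping)] -/
theorem not_b9_main_over_stage2 :
    ¬ ∀ w : WorldP, Node00.IsWorldOfRecord₂ w → ∀ P : B12.RunParams, Dag.B9_main (leavesP w P) := by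
  obtain ⟨w, hw, h⟩ := exists_isWorldOfRecord₂_not_b9_main
  exact fun hall => h ⟨0, 0, 0⟩ (hall w hw ⟨0, 0, 0⟩)

/-! ## §3 At Stage 3: N03 ⇒ ¬ N06 at some world of record -/

/-- **At some Stage-3 world of record, N03 implies ¬ N06 for every run.**  Stage 3 pins the [B6] block to the tower block of record
(`Node00.D6OfRecord θ`), whose leaf `b6` is N03's (open modulo the Prop. 2.6 census, `Node00.b6_main_of_isWorldOfRecord₃_of_prop26`); the B9 bundle
is still free, so at the world whose runs carry the witness of `exists_not_b9LeafX`: `Dag.B6_main` (⇔ b6, since b4 ∕ b5 hold) makes N06's antecedents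
all true while its leaf fails.  Stage-3 parameters: the root's admissible `θ` (`D = 4`), `𝔸 := ℂ`, `d₆ := 3`, `ℓ₆ := L − 1`, band `b₀ = b₁ = 1`, rate
`δ₀ := 2∕L`. [cite: Balaban1985BackgroundPropagators, Thms 3.1–3.15 pp.397–432; Balaban1984PropagatorsII, pp.223–250 (bookkeeping over the staged predicates)] -/
theorem exists_isWorldOfRecord₃_b6_main_imp_not_b9_main :
    ∃ w : WorldP, Node00.IsWorldOfRecord₃ w ∧
      ∀ P : B12.RunParams, Dag.B6_main (leavesP w P) → ¬ Dag.B9_main (leavesP w P) := by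
  obtain ⟨θ, hθ, hD⟩ := Node00.Stage1Params.exists_admissible
  obtain ⟨X⟩ := Node00.nonempty_printedCarriersR
  obtain ⟨Y, -, hY⟩ := exists_not_b9LeafX
  obtain ⟨Z⟩ := Node00.nonempty_printedCarriers11
  obtain ⟨V⟩ := Node00.nonempty_printedCarriers14R
  obtain ⟨W⟩ := Node00.nonempty_printedCarriers15
  obtain ⟨w⟩ := Node00.nonempty_worldP
  have hL1 : 1 ≤ θ.L := le_of_lt θ.hL.2
  have hℓ : (θ.L - 1 : ℕ) + 1 = θ.L := Nat.sub_add_cancel hL1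
  have hℓpos : (0 : ℝ) < ((θ.L - 1 : ℕ) : ℝ) + 1 := by positivity
  let θ₃ : Node00.Stage3Params :=
    { θ with
      𝔸 := ℂ, d₆ := 3, ℓ₆ := θ.L - 1, hd₆ := by rw [hD], hℓ₆ := hℓ, b₀ := 1, b₁ := 1, hb := ⟨one_pos, le_rfl⟩
      δ₀ := 2 / (((θ.L - 1 : ℕ) : ℝ) + 1), hδ₀ := ⟨by positivity, le_rfl⟩ }
  refine ⟨Node00.WorldP.withUp w fun _ => Upstream.ofPrintedAllXPN (Node00.carriers₃ θ₃ X) Y Z V W,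
    Node00.isWorldOfRecord₃_of_up θ₃ hθ X Y Z V W _ rfl, fun P h6main hmain => hY ?_⟩
  have hb4 : (Upstream.ofPrintedAllXPN (Node00.carriers₃ θ₃ X) Y Z V W).b4 := Node00.carriers₁_b4 _ hθ _ Y Z V W
  have hb5 : (Upstream.ofPrintedAllXPN (Node00.carriers₃ θ₃ X) Y Z V W).b5 := Node00.carriers₁_b5 _ hθ _ Y Z V W
  have hb7 : (Upstream.ofPrintedAllXPN (Node00.carriers₃ θ₃ X) Y Z V W).b7 :=
    Node00.carriers₂_b7 θ₃.toStage2Params (Node00.withB6KOfRecord X θ₃) Y Z V W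
  exact hmain hb4 hb5 (h6main hb4 hb5) hb7

/-- **Hence the Stage-3 frame cannot carry N03 ∧ N06** (the first two nodes of the K2 cluster «FlowBounds») at all its worlds of record: a later
NODE 00 stage pinning the B9 bundle is REQUIRED before `stub_N06` is typed (R422). [cite: Balaban1985BackgroundPropagators, Thms 3.1–3.15 pp.397–432 (bookkeeping)] -/
theorem not_b6_and_b9_main_over_stage3 :
    ¬ ∀ w : WorldP, Node00.IsWorldOfRecord₃ w →
      ∀ P : B12.RunParams, Dag.B6_main (leavesP w P) ∧ Dag.B9_main (leavesP w P) := by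
  obtain ⟨w, hw, h⟩ := exists_isWorldOfRecord₃_b6_main_imp_not_b9_main
  exact fun hall => h ⟨0, 0, 0⟩ (hall w hw ⟨0, 0, 0⟩).1 (hall w hw ⟨0, 0, 0⟩).2

end Literature.MathematicalPhysics.QuantumFieldTheory.Balaban1983to89.B9LeafUnpinned

end
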